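import Literature.NumberTheory.Automorphic.Liu2021.AppendixC.BettiPinningHeckeEndomorphism
import HarnessLib

/-!
# A REFERENCE PRESENTATION of the two Hecke operators at a small level: a `Kc`-normal source level with admissible
# representative systems of `Kc t₁ Kc ∕ Kc` and `Kc t₂ Kc ∕ Kc` ([Milne2005ShimuraVarieties] §13 p. 118; [Bump1997] §4.2)

Topic `NumberTheory/Automorphic/Liu2021/AppendixC`; namespace `Literature.NumberTheory.Automorphic.Liu2021.AppendixC`.
THEOREMS ONLY (no definition, no instance, no notation, no named fact, no `sorry`); pure topological-group bookkeeping in the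
currency of ★ `HeckeTranslates` (`C5.OpenCompactSubgroup`, `C5.SmallLevel`, `C5.HeckeLE`) and ★ `BettiPinningHeckeEndomorphism`
(`C5.SmallLevel.exists_normal_le_forall_heckeLE`).  Cell `hodgecm-mathlib` (D-0151), programme P6 «MOD», half A line L1
(socket `stub_LINES` of `Cruxes/HLiu418/Lines/F0_P6a_DatumOfInputs.lean`; crux item stmt-HodgeConjecture-24832, `--supports`):
organ `stub_REF` of the L1 closer skeleton (LA1-plan DEAL v1, 2026-09-02).  HONEST LABEL: HC_CM is proved only modulo the 7
printed citations (2 remaining named inputs hLiu418 24832, h413 24833) until rung 0 closes; this file is count-neutral glue.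

## What, and why
The `hecke` clause of the P6a moduli datum (`ModuliDatum.hecke` ∕ the D-line letter `HeckeClause`) quantifies over every
PRESENTATION `(N′ ≤ Kc, rc₁, rc₂, x′)` of the right `t₁`- and `t₂`-translates of a point of `M⋆_{Kc}`.  Whoever CONSTRUCTS the
readings `quotΩ`∕`translΩ` does so at ONE reference presentation and then transports (lift-independence + presentation change).
This file supplies the reference presentation, for an arbitrary topological group `H`, open compact `K₀`, small level `Kc ≤ K₀`
and ANY two elements `t₁ t₂ : H`:

* `C5.SmallLevel.finite_orbit` — the `Kc`-orbit of `t Kc` in `H ⧸ Kc` (= `Kc t Kc ∕ Kc`) is finite (compact open `Kc` is a Hecke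
  pair with `H`: ★ `isHeckeTriple_top_of_isCompact_isOpen`, ★ `finite_orbit_quotient`);
* `C5.SmallLevel.exists_coset_representatives` — a system of representatives `rd : Kc t Kc ∕ Kc → H`, `rd β ∈ β`;
* **`exists_normal_referencePresentation`** — a level `N₀ ≤ Kc` NORMALISED by `Kc` (`∀ k ∈ Kc, k⁻¹ N₀ k ⊆ N₀`) together with
  representative systems `rd₁` of `Kc t₁ Kc ∕ Kc` and `rd₂` of `Kc t₂ Kc ∕ Kc` that are ADMISSIBLE at `N₀`
  (`C5.HeckeLE (rdᵢ β) N₀ Kc`, i.e. `(rdᵢ β)⁻¹ N₀ (rdᵢ β) ⊆ Kc`, so that the translates `T_{rdᵢ β} : M⋆_{N₀} → M⋆_{Kc}` exist) —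
  ★ `exists_normal_le_forall_heckeLE` applied to the finite set `rd₁(Kc t₁ Kc ∕ Kc) ∪ rd₂(Kc t₂ Kc ∕ Kc)`, keeping its normality
  conjunct (the normality is what makes two lifts of a point to `M⋆_{N₀}` differ by a translate `T_k`, `k ∈ Kc`).

## References
* [Milne2005ShimuraVarieties] J. S. Milne, *Introduction to Shimura varieties* (2005), §13 p. 118 L21–26 (the translates `T_g`
  at a level `K′ ⊆ K ∩ gKg⁻¹`), §5 p. 57 L7–12.
* [Bump1997] D. Bump, *Automorphic Forms and Representations* (1997), §4.2, proof of Prop. 4.2.3 (double cosets of a compact open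
  subgroup are finite unions of single cosets).
* [Liu2021] Y. Liu, *Fourier–Jacobi cycles and arithmetic relative trace formula*, Camb. J. Math. 9 (2021), §4.2 (FJcycle.tex
  l. 2060–2074), Prop. D.8 (1) p. 135.
-/

set_option autoImplicit false

open MulAction

namespace Literature.NumberTheory.Automorphic.Liu2021.AppendixC

variable {H : Type} [Group H] [TopologicalSpace H] [IsTopologicalGroup H] {K₀ : C5.OpenCompactSubgroup H}

/-! ### §1 The double coset `Kc t Kc ∕ Kc` of a small level is finite, and has a system of representatives -/

/-- **`Kc t Kc ∕ Kc` is finite for a small level `Kc`**: the `Kc`-orbit of `t Kc` in `H ⧸ Kc` is finite, `Kc` being compact open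
(★ `isHeckeTriple_top_of_isCompact_isOpen` + ★ `finite_orbit_quotient`). [cite: Bump1997, §4.2 (Prop. 4.2.3, proof)] -/
theorem C5.SmallLevel.finite_orbit (K : C5.SmallLevel K₀) (t : H) :
    (orbit (K.1.1 : Subgroup H) (t : H ⧸ (K.1.1 : Subgroup H))).Finite := by
  haveI := Literature.NumberTheory.Automorphic.isHeckeTriple_top_of_isCompact_isOpen (K.1.1 : Subgroup H) K.1.2.2 K.1.2.1
  exact Literature.NumberTheory.Automorphic.finite_orbit_quotient (K.1.1 : Subgroup H) t

omit [IsTopologicalGroup H] in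
/-- A system of representatives of the cosets in `Kc t Kc ∕ Kc` (`Quotient.out`); stated as an existence so that no definition is
introduced. [cite: Milne2005ShimuraVarieties, §13 p. 118 L21–26] -/
theorem C5.SmallLevel.exists_coset_representatives (K : C5.SmallLevel K₀) (t : H) :
    ∃ rd : orbit (K.1.1 : Subgroup H) (t : H ⧸ (K.1.1 : Subgroup H)) → H,
      ∀ β, ((rd β : H) : H ⧸ (K.1.1 : Subgroup H)) = β.1 :=
  ⟨fun β => Quotient.out β.1, fun β => Quotient.out_eq β.1⟩

/-! ### §2 The reference presentation -/

/-- **A REFERENCE PRESENTATION of `t₁`, `t₂` at the small level `Kc`**: there are a level `N₀ ≤ Kc` normalised by `Kc`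
(`∀ k ∈ Kc, C5.HeckeLE k N₀ N₀`) and systems of representatives `rd₁` of `Kc t₁ Kc ∕ Kc`, `rd₂` of `Kc t₂ Kc ∕ Kc` admissible at
`N₀` (`C5.HeckeLE (rdᵢ β) N₀ Kc`: the Hecke translates `T_{rdᵢ β} : M⋆_{N₀} → M⋆_{Kc}` are defined).  Proof: both orbits are finite
(§1), take `Quotient.out` representatives and apply ★ `C5.SmallLevel.exists_normal_le_forall_heckeLE` to the finite set of all of
them.  These are the binders `(N₀, rd₁, rd₂)` at which a constructor of the moduli readings pays the `hecke` clause once.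
[cite: Milne2005ShimuraVarieties, §13 p. 118 L21–26] [cite: Liu2021, §4.2 (FJcycle.tex l. 2060–2074); Prop. D.8 (1) p. 135] -/
theorem exists_normal_referencePresentation (Kc : C5.SmallLevel K₀) (t₁ t₂ : H) :
    ∃ N₀ : C5.SmallLevel K₀, ∃ _hN₀Kc : N₀ ≤ Kc, (∀ k ∈ (Kc.1.1 : Subgroup H), C5.HeckeLE k N₀ N₀) ∧
      (∃ rd₁ : orbit (Kc.1.1 : Subgroup H) (t₁ : H ⧸ (Kc.1.1 : Subgroup H)) → H,
        (∀ β, ((rd₁ β : H) : H ⧸ (Kc.1.1 : Subgroup H)) = β.1) ∧ ∀ β, C5.HeckeLE (rd₁ β) N₀ Kc) ∧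
      ∃ rd₂ : orbit (Kc.1.1 : Subgroup H) (t₂ : H ⧸ (Kc.1.1 : Subgroup H)) → H,
        (∀ β, ((rd₂ β : H) : H ⧸ (Kc.1.1 : Subgroup H)) = β.1) ∧ ∀ β, C5.HeckeLE (rd₂ β) N₀ Kc := by
  classical
  haveI := (C5.SmallLevel.finite_orbit Kc t₁).fintype
  haveI := (C5.SmallLevel.finite_orbit Kc t₂).fintype
  obtain ⟨rd₁, hrd₁⟩ := C5.SmallLevel.exists_coset_representatives Kc t₁
  obtain ⟨rd₂, hrd₂⟩ := C5.SmallLevel.exists_coset_representatives Kc t₂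
  obtain ⟨N₀, hN₀Kc, hn₀, hγ⟩ :=
    C5.SmallLevel.exists_normal_le_forall_heckeLE (Finset.univ.image rd₁ ∪ Finset.univ.image rd₂) Kc
  refine ⟨N₀, hN₀Kc, hn₀, ⟨rd₁, hrd₁, fun β => ?_⟩, ⟨rd₂, hrd₂, fun β => ?_⟩⟩
  · exact hγ _ (Finset.mem_union_left _ (Finset.mem_image_of_mem _ (Finset.mem_univ β)))
  · exact hγ _ (Finset.mem_union_right _ (Finset.mem_image_of_mem _ (Finset.mem_univ β)))

/-- **Corollary (ONE operator)**: a `Kc`-normal level `N₀ ≤ Kc` with a representative system of `Kc t Kc ∕ Kc` admissible at `N₀`.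
[cite: Milne2005ShimuraVarieties, §13 p. 118 L21–26] -/
theorem exists_normal_referencePresentation₁ (Kc : C5.SmallLevel K₀) (t : H) :
    ∃ N₀ : C5.SmallLevel K₀, ∃ _hN₀Kc : N₀ ≤ Kc, (∀ k ∈ (Kc.1.1 : Subgroup H), C5.HeckeLE k N₀ N₀) ∧
      ∃ rd : orbit (Kc.1.1 : Subgroup H) (t : H ⧸ (Kc.1.1 : Subgroup H)) → H,
        (∀ β, ((rd β : H) : H ⧸ (Kc.1.1 : Subgroup H)) = β.1) ∧ ∀ β, C5.HeckeLE (rd β) N₀ Kc := by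
  obtain ⟨N₀, hN₀Kc, hn₀, h₁, -⟩ := exists_normal_referencePresentation Kc t t
  exact ⟨N₀, hN₀Kc, hn₀, h₁⟩

end Literature.NumberTheory.Automorphic.Liu2021.AppendixC
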